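import Literature.Computability.Cryptography.BLPRSSection4GridParams
import HarnessLib

/-!
# BLPRS 2013, §3–§4 in the regime of pqc.S21, III: sample counts, thresholds and the eventual inequalities of the capstone

Topic `Computability/Cryptography` (LWE), grouping namespace `BLPRS2013`; sequel of `BLPRSSection4Params.lean` and
`BLPRSSection4GridParams.lean`. The law-level chain `section4_selected` (`BLPRSSection4Assembly.lean`) turns a test
`K` of `m₃` samples of `LWE_{n,q,Ψ̄_α}` into ONE test of `LWE_{d,Q,Ψ̄_{α₂}}` under a list of numeric side conditions;
this file fixes the remaining parameter functions of `n` (numbers of guesses/batches/samples/selection runs, the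
selection threshold) and PROVES that every side condition holds for all large `n` in the regime of pqc.S21
(`d = ⌊√n⌋`, `Q = 2^{⌊d/2⌋+2}`, `α₂ = α/(8d)`, `ε = n^{-c}`, `θ = 1/(4n^{c₃+1})`). Everything PROVED, definitions
with bodies, no named fact:

* `gridBatches` (`N = N' = 1024(G+2)n^{2c₃+2}`), `sampleCount` (`m = G·(N·m₃)`), `etaStar = 1/(12m)`,
  `selRuns = 768(12m)³`; **`grid_estimation_error_le`** (`(G+1)·4/(Nθ²) + 8/(N'θ²) ≤ 1/8`),
  **`selection_gain`** (`η⋆/2 - 2·3·32/(N_sel η⋆²) = 1/(48m)`);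
* **`eventually_threshold_budget`** (`4θ + m₃·8√π/(Dqα) ≤ 1/n^{c₃}` for a suitable grid exponent `c_D`: the
  tolerance of the grid guess fits under the promised advantage);
* **`eventually_noise_smoothing`** (the smoothing hypothesis of Lemma 2.9 for the first hybrid's noise,
  `Q⁻¹√(ln(2n(1+n^c))/π) ≤ 1/√(1/r_N² + n/γ²) = α₂√(5/2)`: exponential `Q` beats polynomial);
* **`eventually_lhl_condition`** (Lemma 2.2: `(d+1)·log₂ Q + 2 log₂ n^c ≤ n`);
* `primeFactors_modulus`, **`eventually_ell_term`** (`2m(2^{-(d+1)} + n^{-c₄₇}) ≤ 1/4` for a suitable `c₄₇`),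
  **`eventually_raise_term`** (`m/(2Qα₂) ≤ 1/(12m)`), **`etaStar_admissible`** (the threshold inequality `hη` of
  `section4_selected` from `T ≥ 3/4`), **`eventually_final_advantage`** (`1/n^{c'} ≤ 1/(48m)`).

## References

* Z. Brakerski, A. Langlois, C. Peikert, O. Regev, D. Stehlé, *Classical hardness of learning with errors*, STOC 2013;
  arXiv:1306.0281, p. 13 (all losses `1/poly` or negligible), Thm. 4.1 (proof), Lemma 2.2, Lemma 2.9, Lemma 2.15, Cor. 3.2.
  [BrakerskiEtAl2013]
* O. Regev, *On lattices, learning with errors …*, J. ACM 56 (2009), Lemma 4.1, Claim 2.2. [RegevLWE2009]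
-/

noncomputable section

open Filter Literature.Algebra.EuclideanLattices Literature.Computability.Complexity
open scoped Real

namespace Literature.Computability.Cryptography

namespace BLPRS2013

open LWE

variable {q : ℕ → ℕ} {α : ℕ → ℝ} {m₃ : ℕ → ℕ}

/-! ### Counts -/

variable (q) in
/-- **Batches per guess (and reference runs)** `N = N' = 1024·(G+2)·n^{2c₃+2}` (for `θ = 1/(4n^{c₃+1})`).
[cite: BrakerskiEtAl2013, Lemma 2.15 (proof sketch: Chernoff)] -/
def gridBatches (cD c₃ n : ℕ) : ℕ := 1024 * (gridG q cD n + 2) * n ^ (2 * c₃ + 2)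

variable (q m₃) in
/-- **The number of `binLWE` samples** `m = G·(N·m₃)` consumed by the rate-guess test. [cite: BrakerskiEtAl2013, Lemma 2.15 ("`m' = m·poly`")] -/
def sampleCount (cD c₃ n : ℕ) : ℕ := gridG q cD n * (gridBatches q cD c₃ n * m₃ n)

variable (q m₃) in
/-- **The selection threshold** `η⋆ = 1/(12m)`. [cite: BrakerskiEtAl2013, Thm. 4.1 (proof: one of the three advantages is `≥ …/(2m+1)`)] -/
def etaStar (cD c₃ n : ℕ) : ℝ := 1 / (12 * (sampleCount q m₃ cD c₃ n : ℝ))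

variable (q m₃) in
/-- **The number of self-generated runs of the selection** `N_sel = 768·(12m)³`. [cite: RegevLWE2009, Lemma 4.1 (proof: estimate by sampling)] -/
def selRuns (cD c₃ n : ℕ) : ℕ := 768 * (12 * sampleCount q m₃ cD c₃ n) ^ 3

/-- `N > 0` for `n ≥ 1`. [folklore] -/
theorem gridBatches_pos {cD c₃ n : ℕ} (hn : 0 < n) : 0 < gridBatches q cD c₃ n := by
  unfold gridBatches; positivity

/-- `m > 0` for `n ≥ 1` and `m₃(n) ≥ 1`. [folklore] -/
theorem sampleCount_pos {cD c₃ n : ℕ} (hn : 0 < n) (hm : 0 < m₃ n) : 0 < sampleCount q m₃ cD c₃ n := by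
  unfold sampleCount
  exact Nat.mul_pos (gridG_pos cD n) (Nat.mul_pos (gridBatches_pos hn) hm)

/-- **The estimation error fits**: `(G+1)·4/(Nθ²) + 8/(N'θ²) ≤ 1/8` for `θ = 1/(4n^{c₃+1})`, `N = N' = gridBatches`.
[cite: BrakerskiEtAl2013, Lemma 2.15 (proof sketch)] -/
theorem grid_estimation_error_le {cD c₃ n : ℕ} (hn : 0 < n) :
    ((gridG q cD n : ℝ) + 1) * (4 / (gridBatches q cD c₃ n * advThreshold (c₃ + 1) n ^ 2)) +
        8 / (gridBatches q cD c₃ n * advThreshold (c₃ + 1) n ^ 2) ≤ 1 / 8 := by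
  have hn' : (0 : ℝ) < n := by exact_mod_cast hn
  have hp : (0 : ℝ) < (n : ℝ) ^ (c₃ + 1) := by positivity
  set G : ℝ := (gridG q cD n : ℝ) with hG
  have hG0 : 0 ≤ G := by rw [hG]; positivity
  have hθ : advThreshold (c₃ + 1) n ^ 2 = 1 / (16 * ((n : ℝ) ^ (c₃ + 1)) ^ 2) := by
    unfold advThreshold; field_simp; ring
  have hN : (gridBatches q cD c₃ n : ℝ) = 1024 * (G + 2) * ((n : ℝ) ^ (c₃ + 1)) ^ 2 := by
    unfold gridBatches
    rw [hG]
    push_cast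
    ring
  rw [hθ, hN]
  have hx : 0 < ((n : ℝ) ^ (c₃ + 1)) ^ 2 := by positivity
  rw [show 1024 * (G + 2) * ((n : ℝ) ^ (c₃ + 1)) ^ 2 * (1 / (16 * ((n : ℝ) ^ (c₃ + 1)) ^ 2)) = 64 * (G + 2) by
    field_simp; ring]
  rw [show (G + 1) * (4 / (64 * (G + 2))) + 8 / (64 * (G + 2)) = (4 * G + 12) / (64 * (G + 2)) by
    field_simp; ring]
  rw [div_le_div_iff₀ (by positivity) (by norm_num)]
  nlinarith

/-- **The selection gain**: `η⋆/2 - 2·(3·(32/(N_sel η⋆²))) = 1/(48m)` for `η⋆ = 1/(12m)`, `N_sel = 768(12m)³` (`m ≥ 1`).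
[cite: RegevLWE2009, Lemma 4.1 (proof)] -/
theorem selection_gain {cD c₃ n : ℕ} (hm : 0 < sampleCount q m₃ cD c₃ n) :
    etaStar q m₃ cD c₃ n / 2 - 2 * ((2 + 1 : ℕ) * (32 / (selRuns q m₃ cD c₃ n * etaStar q m₃ cD c₃ n ^ 2))) =
      1 / (48 * (sampleCount q m₃ cD c₃ n : ℝ)) := by
  have hm' : (0 : ℝ) < sampleCount q m₃ cD c₃ n := by exact_mod_cast hm
  unfold etaStar selRuns
  push_cast
  field_simp
  ring

/-! ### The threshold budget: the grid tolerance fits under the promised advantage -/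

/-- **`4θ + m₃·8√π/(Dqα) ≤ 1/n^{c₃}`** eventually, for `θ = 1/(4n^{c₃+1})` and a grid exponent `c_D` depending on the
polynomial bound of `m₃` (`αq ≥ 1`, `√π ≤ 2`, `D = 8n^{c_D}`). [cite: BrakerskiEtAl2013, Lemma 2.15 with p. 13; RegevLWE2009, Claim 2.2] -/
theorem eventually_threshold_budget (hm : IsPolyBounded m₃) (c₃ : ℕ)
    (hα : ∀ᶠ n : ℕ in atTop, 0 < α n ∧ α n < 1 ∧ Real.sqrt n * Real.log n ≤ α n * q n) :
    ∃ cD : ℕ, ∀ᶠ n : ℕ in atTop,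
      4 * advThreshold (c₃ + 1) n + (m₃ n : ℝ) * (8 * √π / (gridD cD n * q n * α n)) ≤ 1 / (n : ℝ) ^ c₃ := by
  obtain ⟨cD, hcD⟩ := eventually_polyBounded_le_pow hm 4 c₃
  refine ⟨cD, ?_⟩
  filter_upwards [hcD, eventually_inv_rate_le hα, eventually_ge_atTop 2] with n hmn hinv h2
  obtain ⟨hα0, -, h1αq, -⟩ := hinv
  have hn : (2 : ℝ) ≤ n := by exact_mod_cast h2
  have hn0 : (0 : ℝ) < n := by linarith
  have hq0 : (0 : ℝ) < q n := by
    by_contra h; push Not at h; nlinarith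
  have hp : (0 : ℝ) < (n : ℝ) ^ c₃ := by positivity
  have hpD : (0 : ℝ) < (n : ℝ) ^ cD := by positivity
  have hsπ : √π ≤ 2 := by
    rw [Real.sqrt_le_left (by norm_num)]
    linarith [Real.pi_lt_d2]
  -- `4θ = 1/n^{c₃+1} ≤ 1/(2n^{c₃})`
  have h1 : 4 * advThreshold (c₃ + 1) n ≤ 1 / (2 * (n : ℝ) ^ c₃) := by
    unfold advThreshold
    rw [show 4 * (1 / (4 * (n : ℝ) ^ (c₃ + 1))) = 1 / ((n : ℝ) ^ c₃ * n) by field_simp; ring]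
    rw [div_le_div_iff₀ (by positivity) (by positivity)]
    nlinarith
  -- `m₃·8√π/(Dqα) ≤ 16 m₃/(8 n^{c_D}) ≤ 1/(2n^{c₃})` by `4 m₃ n^{c₃} ≤ n^{c_D}`
  have h2' : (m₃ n : ℝ) * (8 * √π / (gridD cD n * q n * α n)) ≤ 1 / (2 * (n : ℝ) ^ c₃) := by
    have hD : (gridD cD n : ℝ) = 8 * (n : ℝ) ^ cD := by unfold gridD; push_cast; ring
    rw [hD]
    have hden : 0 < 8 * (n : ℝ) ^ cD * q n * α n := by positivity
    rw [mul_div_assoc', div_le_div_iff₀ hden (by positivity)]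
    have hm0 : (0 : ℝ) ≤ m₃ n := Nat.cast_nonneg _
    calc (m₃ n : ℝ) * (8 * √π) * (2 * (n : ℝ) ^ c₃) ≤ (m₃ n : ℝ) * (8 * 2) * (2 * (n : ℝ) ^ c₃) := by gcongr
      _ = 8 * (4 * (m₃ n : ℝ) * (n : ℝ) ^ c₃) := by ring
      _ ≤ 8 * (n : ℝ) ^ cD := by nlinarith
      _ = 1 * (8 * (n : ℝ) ^ cD * 1) := by ring
      _ ≤ 1 * (8 * (n : ℝ) ^ cD * (q n * α n)) := by
          refine mul_le_mul_of_nonneg_left (mul_le_mul_of_nonneg_left ?_ (by positivity)) (by norm_num)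
          linarith
      _ = 1 * (8 * (n : ℝ) ^ cD * q n * α n) := by ring
  calc 4 * advThreshold (c₃ + 1) n + (m₃ n : ℝ) * (8 * √π / (gridD cD n * q n * α n))
      ≤ 1 / (2 * (n : ℝ) ^ c₃) + 1 / (2 * (n : ℝ) ^ c₃) := add_le_add h1 h2'
    _ = 1 / (n : ℝ) ^ c₃ := by field_simp; ring

/-! ### The smoothing hypothesis of the first hybrid's noise (Lemma 2.9) -/

/-- The right-hand side of the smoothing hypothesis in closed form: `1/√(1/(√5a)² + n/(√(5n)a)²) = a√(5/2)`. [folklore] -/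
theorem rhs_noise_eq {a : ℝ} (ha : 0 < a) {n : ℕ} (hn : 0 < n) :
    1 / Real.sqrt (1 / (Real.sqrt 5 * a) ^ 2 + n / (Real.sqrt (5 * n) * a) ^ 2) = a * Real.sqrt (5 / 2) := by
  have hn' : (0 : ℝ) < n := by exact_mod_cast hn
  have h5 : (Real.sqrt 5 * a) ^ 2 = 5 * a ^ 2 := by rw [mul_pow, Real.sq_sqrt (by norm_num)]
  have h5n : (Real.sqrt (5 * n) * a) ^ 2 = 5 * n * a ^ 2 := by rw [mul_pow, Real.sq_sqrt (by positivity)]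
  rw [h5, h5n]
  have hin : 1 / (5 * a ^ 2) + n / (5 * n * a ^ 2) = (a * Real.sqrt (5 / 2))⁻¹ ^ 2 := by
    rw [inv_pow, mul_pow, Real.sq_sqrt (by norm_num)]
    field_simp
    ring
  rw [hin, Real.sqrt_sq (by positivity), one_div, inv_inv]

/-- `α₂ ≥ 1/(8nq)` when `αq ≥ 1` (`d ≤ n`). [folklore] -/
theorem rate₂_ge_inv {n : ℕ} (hn : 0 < n) (hq0 : 0 < (q n : ℝ)) (h1αq : 1 ≤ α n * q n) :
    1 / (8 * n * q n) ≤ rate₂ α n := by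
  have hn' : (0 : ℝ) < n := by exact_mod_cast hn
  have hdn : (dim n : ℝ) ≤ n := by exact_mod_cast Nat.sqrt_le_self n
  have hd1 : (1 : ℝ) ≤ dim n := by exact_mod_cast Nat.sqrt_pos.2 hn
  unfold rate₂
  rw [div_le_div_iff₀ (by positivity) (by positivity), one_mul]
  calc 8 * (dim n : ℝ) ≤ 8 * n := by linarith
    _ = 1 * (8 * n) := by ring
    _ ≤ (α n * q n) * (8 * n) := mul_le_mul_of_nonneg_right h1αq (by positivity)
    _ = α n * (8 * n * q n) := by ring

/-- **The smoothing hypothesis, pointwise**: if `n ≥ 4`, `0 < α < 1 ≤ αq` and `64(c+3)n³q² ≤ Q`, then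
`Q⁻¹√(ln(2n(1+n^c))/π) ≤ 1/√(1/r_N² + n/γ²)` with `r_N = √5·α₂`, `γ = √(5n)·α₂`.
[cite: BrakerskiEtAl2013, Lemma 2.9 with Lemma 2.5 and Lemma 4.9 (proof)] -/
theorem noise_smoothing_of {c n : ℕ} (h4 : 4 ≤ n) (hα0 : 0 < α n) (h1αq : 1 ≤ α n * q n)
    (hpoly : 64 * ((c : ℝ) + 3) * ((n : ℝ) ^ 3 * (q n : ℝ) ^ 2) ≤ modulus n) :
    ((modulus n : ℕ) : ℝ)⁻¹ * Real.sqrt (Real.log (2 * n * (1 + 1 / (1 / (n : ℝ) ^ c))) / π) ≤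
      1 / Real.sqrt (1 / (Real.sqrt 5 * rate₂ α n) ^ 2 + n / (Real.sqrt (5 * n) * rate₂ α n) ^ 2) := by
  have hn : 0 < n := by omega
  have hn4 : (4 : ℝ) ≤ n := by exact_mod_cast h4
  have hn0 : (0 : ℝ) < n := by linarith
  have hq0 : (0 : ℝ) < q n := by
    by_contra h
    push Not at h
    have : α n * q n ≤ 0 := mul_nonpos_of_nonneg_of_nonpos hα0.le h
    linarith
  have hπ := Real.pi_pos
  have hQ : (0 : ℝ) < modulus n := by exact_mod_cast Nat.pos_of_ne_zero (NeZero.ne (modulus n))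
  have hα₂ := rate₂_ge_inv hn hq0 h1αq
  have hα₂pos : 0 < rate₂ α n := lt_of_lt_of_le (by positivity) hα₂
  rw [rhs_noise_eq hα₂pos hn, one_div_one_div, inv_mul_le_iff₀ hQ, Real.sqrt_le_left (by positivity)]
  -- `ln(2n(1+n^c))/π ≤ (c+3)n`
  have hlog : Real.log (2 * n * (1 + (n : ℝ) ^ c)) / π ≤ ((c : ℝ) + 3) * n := by
    have h1 : Real.log (2 * n * (1 + (n : ℝ) ^ c)) ≤ ((c : ℝ) + 3) * n := by
      refine (log_switch_le (c := c) h4).trans ?_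
      have hl : Real.log n ≤ n := (Real.log_le_sub_one_of_pos hn0).trans (by linarith)
      exact mul_le_mul_of_nonneg_left hl (by positivity)
    rw [div_le_iff₀ hπ]
    have h1π : (1 : ℝ) ≤ π := by linarith [Real.pi_gt_three]
    calc Real.log (2 * n * (1 + (n : ℝ) ^ c)) ≤ ((c : ℝ) + 3) * n := h1
      _ = ((c : ℝ) + 3) * n * 1 := by ring
      _ ≤ ((c : ℝ) + 3) * n * π := mul_le_mul_of_nonneg_left h1π (by positivity)
  -- `(c+3)n ≤ (8(c+3)n²q)² ≤ (Qα₂)²`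
  have hQα : 8 * ((c : ℝ) + 3) * (n : ℝ) ^ 2 * q n ≤ modulus n * rate₂ α n := by
    have h1 : 8 * ((c : ℝ) + 3) * (n : ℝ) ^ 2 * q n =
        (64 * ((c : ℝ) + 3) * ((n : ℝ) ^ 3 * (q n : ℝ) ^ 2)) * (1 / (8 * n * q n)) := by
      field_simp
      ring
    rw [h1]
    exact mul_le_mul hpoly hα₂ (by positivity) hQ.le
  have hq1 : (1 : ℝ) ≤ q n := by
    have : 0 < q n := by exact_mod_cast hq0
    exact_mod_cast this
  have hY : ((c : ℝ) + 3) * n ≤ 8 * ((c : ℝ) + 3) * (n : ℝ) ^ 2 * q n := by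
    have e : 8 * ((c : ℝ) + 3) * (n : ℝ) ^ 2 * q n = ((c : ℝ) + 3) * n * (8 * (n * q n)) := by ring
    rw [e]
    refine le_mul_of_one_le_right (by positivity) ?_
    have : (1 : ℝ) ≤ n * q n := by nlinarith
    linarith
  have hge1 : (1 : ℝ) ≤ 8 * ((c : ℝ) + 3) * (n : ℝ) ^ 2 * q n := by
    refine le_trans ?_ hY
    have hc : (0 : ℝ) ≤ c := Nat.cast_nonneg c
    nlinarith
  have hself : 8 * ((c : ℝ) + 3) * (n : ℝ) ^ 2 * q n ≤ (8 * ((c : ℝ) + 3) * (n : ℝ) ^ 2 * q n) ^ 2 :=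
    le_self_pow₀ hge1 two_ne_zero
  have hsq' : (8 * ((c : ℝ) + 3) * (n : ℝ) ^ 2 * q n) ^ 2 ≤ (modulus n * rate₂ α n) ^ 2 :=
    pow_le_pow_left₀ (by positivity) hQα 2
  have hsq : ((modulus n : ℝ) * (rate₂ α n * Real.sqrt (5 / 2))) ^ 2 = (modulus n * rate₂ α n) ^ 2 * (5 / 2) := by
    rw [show (modulus n : ℝ) * (rate₂ α n * Real.sqrt (5 / 2)) = (modulus n * rate₂ α n) * Real.sqrt (5 / 2) by ring,
      mul_pow, Real.sq_sqrt (by norm_num)]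
  rw [hsq]
  have hnn : 0 ≤ (modulus n * rate₂ α n : ℝ) ^ 2 := sq_nonneg _
  linarith

/-- **`Q⁻¹√(ln(2n(1+n^c))/π) ≤ 1/√(1/r_N² + n/γ²)`** eventually, with `r_N = √5·α₂`, `γ = √(5n)·α₂` (so the right-hand
side is `α₂√(5/2)`): `Q = 2^{⌊d/2⌋+2}` beats every polynomial while `α₂ ≥ 1/(8nq)` and `ln(2n(1+n^c)) ≤ (c+3)n`.
[cite: BrakerskiEtAl2013, Lemma 2.9 with Lemma 2.5 and Lemma 4.9 (proof)] -/
theorem eventually_noise_smoothing (hq : IsPolyBounded q) (c : ℕ)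
    (hα : ∀ᶠ n : ℕ in atTop, 0 < α n ∧ α n < 1 ∧ Real.sqrt n * Real.log n ≤ α n * q n) :
    ∀ᶠ n : ℕ in atTop, ((modulus n : ℕ) : ℝ)⁻¹ * Real.sqrt (Real.log (2 * n * (1 + 1 / (1 / (n : ℝ) ^ c))) / π) ≤
      1 / Real.sqrt (1 / (Real.sqrt 5 * rate₂ α n) ^ 2 + n / (Real.sqrt (5 * n) * rate₂ α n) ^ 2) := by
  obtain ⟨pq, hpq⟩ := hq
  have hexp := eventually_mul_eval_le_two_pow_half_dim (Polynomial.X ^ 3 * pq ^ 2) (64 * ((c : ℝ) + 3))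
  filter_upwards [hexp, eventually_inv_rate_le hα, eventually_ge_atTop 4] with n hexpn hinv h4
  obtain ⟨hα0, -, h1αq, -⟩ := hinv
  refine noise_smoothing_of h4 hα0 h1αq ?_
  have hQge : (2 : ℝ) ^ (dim n / 2) ≤ modulus n := by
    unfold modulus
    push_cast
    rw [pow_add]
    have h2 : (0 : ℝ) < (2 : ℝ) ^ (dim n / 2) := by positivity
    nlinarith
  have hqle : (q n : ℝ) ≤ ((pq.eval n : ℕ) : ℝ) := by exact_mod_cast hpq n
  have hev : (64 * ((c : ℝ) + 3)) * ((n : ℝ) ^ 3 * ((pq.eval n : ℕ) : ℝ) ^ 2) ≤ (2 : ℝ) ^ (dim n / 2) := by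
    have h := hexpn
    simp only [Polynomial.eval_mul, Polynomial.eval_pow, Polynomial.eval_X, Nat.cast_mul, Nat.cast_pow] at h
    exact h
  calc 64 * ((c : ℝ) + 3) * ((n : ℝ) ^ 3 * (q n : ℝ) ^ 2)
      ≤ (64 * ((c : ℝ) + 3)) * ((n : ℝ) ^ 3 * ((pq.eval n : ℕ) : ℝ) ^ 2) := by gcongr
    _ ≤ (2 : ℝ) ^ (dim n / 2) := hev
    _ ≤ modulus n := hQge

/-! ### The leftover-hash condition (Lemma 2.2) -/

/-- `ln n ≤ 2√n` (`n ≥ 1`). [folklore] -/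
theorem log_le_two_sqrt {x : ℝ} (hx : 0 < x) : Real.log x ≤ 2 * Real.sqrt x := by
  have h := Real.log_le_sub_one_of_pos (Real.sqrt_pos.2 hx)
  rw [Real.log_sqrt hx.le] at h
  linarith [Real.sqrt_nonneg x]

/-- **`(d+1)·log₂ Q + 2·log₂(1/ε) ≤ n`** eventually (`Q = 2^{⌊d/2⌋+2}`, `ε = n^{-c}`): `(d+1)(⌊d/2⌋+2) ≤ n/2 + 2.5√n + 2` and
`2c·log₂ n ≤ 5.8c·√n`. [cite: BrakerskiEtAl2013, Lemma 2.2 (hypothesis `n ≥ k log₂ q + 2 log₂(1/δ)`)] -/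
theorem eventually_lhl_condition (c : ℕ) :
    ∀ᶠ n : ℕ in atTop, ((dim n + 1 : ℕ) : ℝ) * Real.logb 2 (modulus n) + 2 * Real.logb 2 (1 / (1 / (n : ℝ) ^ c)) ≤ n := by
  filter_upwards [eventually_ge_atTop ((14 + 24 * c) ^ 2 + 1)] with n hn
  have hn1 : 1 ≤ n := by omega
  have hn0 : (0 : ℝ) < n := by exact_mod_cast (by omega : 0 < n)
  -- `log₂ Q = ⌊d/2⌋ + 2`
  have hQ : Real.logb 2 (modulus n) = ((dim n / 2 : ℕ) : ℝ) + 2 := by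
    unfold modulus
    rw [Nat.cast_pow, Nat.cast_ofNat, Real.logb_pow, Real.logb_self_eq_one one_lt_two]
    push_cast
    ring
  -- `log₂(n^c) ≤ 1.45 c ln n ≤ 2.9 c √n`
  have hε : Real.logb 2 (1 / (1 / (n : ℝ) ^ c)) ≤ 2.9 * c * Real.sqrt n := by
    rw [one_div_one_div, Real.logb_pow, Real.logb, mul_div_assoc', div_le_iff₀ (Real.log_pos one_lt_two)]
    have h2 := Real.log_two_gt_d9
    have hl := log_le_two_sqrt hn0
    have hc : (0 : ℝ) ≤ c := Nat.cast_nonneg c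
    have hs : 0 ≤ Real.sqrt n := Real.sqrt_nonneg n
    have a1 := mul_le_mul_of_nonneg_left hl hc
    have a2 := mul_le_mul_of_nonneg_left h2.le (by positivity : (0 : ℝ) ≤ 2.9 * c * Real.sqrt n)
    nlinarith [mul_nonneg hc hs]
  -- `d ≤ √n`, `⌊d/2⌋ ≤ d/2`
  have hd : (dim n : ℝ) ≤ Real.sqrt n := by
    rw [dim, Real.le_sqrt (Nat.cast_nonneg _) hn0.le]
    exact_mod_cast Nat.sqrt_le' n
  have hd2 : ((dim n / 2 : ℕ) : ℝ) ≤ (dim n : ℝ) / 2 := by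
    have : (dim n / 2) * 2 ≤ dim n := Nat.div_mul_le_self _ _
    have h' : ((dim n / 2 : ℕ) : ℝ) * 2 ≤ dim n := by exact_mod_cast this
    linarith
  have hsn : Real.sqrt n ^ 2 = n := Real.sq_sqrt hn0.le
  have hsq : (14 + 24 * (c : ℝ)) ≤ Real.sqrt n := by
    rw [Real.le_sqrt (by positivity) hn0.le]
    exact_mod_cast (by omega : (14 + 24 * c) ^ 2 ≤ n)
  rw [hQ]
  push_cast
  have hd0 : (0 : ℝ) ≤ dim n := Nat.cast_nonneg _
  have hc : (0 : ℝ) ≤ c := Nat.cast_nonneg c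
  -- `(d+1)(d/2+2) + 5.8 c √n ≤ n`
  nlinarith [mul_le_mul hd hd hd0 (Real.sqrt_nonneg n), mul_le_mul_of_nonneg_left hd2 (by positivity : (0 : ℝ) ≤ (dim n : ℝ) + 1),
    Real.sqrt_nonneg n, mul_le_mul_of_nonneg_right hsq (Real.sqrt_nonneg n)]

/-! ### The `ℓ`-term, the raising term, the threshold -/

/-- `Q`'s only prime factor is `2`. [folklore] -/
theorem primeFactors_modulus (n : ℕ) : (modulus n).primeFactors = {2} := by
  unfold modulus
  exact Nat.primeFactors_prime_pow (by omega) Nat.prime_two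

/-- The Lemma 4.3 term: `∑_{p ∣ Q} p^{-(d+1)} = 2^{-(d+1)}`. [cite: BrakerskiEtAl2013, Lemma 4.3] -/
theorem sum_primeFactors_modulus (n d : ℕ) :
    ∑ p ∈ (modulus n).primeFactors, ((p : ℝ) ^ (d + 1))⁻¹ = ((2 : ℝ) ^ (d + 1))⁻¹ := by
  rw [primeFactors_modulus, Finset.sum_singleton]
  norm_num

/-- **The sample count is polynomially bounded.** [folklore] -/
theorem isPolyBounded_sampleCount (hq : IsPolyBounded q) (hm : IsPolyBounded m₃) (cD c₃ : ℕ) :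
    IsPolyBounded (sampleCount q m₃ cD c₃) := by
  obtain ⟨pq, hpq⟩ := hq
  obtain ⟨pm, hpm⟩ := hm
  refine ⟨(pq * (8 * Polynomial.X ^ cD) + 1) * ((1024 * ((pq * (8 * Polynomial.X ^ cD) + 1) + 2) * Polynomial.X ^ (2 * c₃ + 2)) * pm), fun n => ?_⟩
  have hG : gridG q cD n ≤ (pq * (8 * Polynomial.X ^ cD) + 1).eval n := by
    unfold gridG gridD
    simp only [Polynomial.eval_add, Polynomial.eval_mul, Polynomial.eval_pow, Polynomial.eval_X, Polynomial.eval_one,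
      Polynomial.eval_ofNat]
    exact Nat.add_le_add_right (Nat.mul_le_mul_right _ (hpq n)) 1
  unfold sampleCount gridBatches
  simp only [Polynomial.eval_add, Polynomial.eval_mul, Polynomial.eval_pow, Polynomial.eval_X, Polynomial.eval_one,
    Polynomial.eval_ofNat] at hG ⊢
  gcongr
  exact hpm n

/-- **The `ℓ`-term fits**: for a suitable `c₄₇`, eventually `2m·(2^{-(d+1)} + n^{-c₄₇}) ≤ 1/4` (`m = sampleCount` polynomial,
`2^{d+1} ≥ 2^{⌊d/2⌋}` beats it). [cite: BrakerskiEtAl2013, Thm. 4.1 (proof: losses `m·∑ p^{-k-1}` and `m·L₄₇`)] -/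
theorem eventually_ell_term (hq : IsPolyBounded q) (hm : IsPolyBounded m₃) (cD c₃ : ℕ) :
    ∃ c₄₇ : ℕ, ∀ᶠ n : ℕ in atTop,
      2 * (sampleCount q m₃ cD c₃ n : ℝ) * (((2 : ℝ) ^ (dim n + 1))⁻¹ + 1 / (n : ℝ) ^ c₄₇) ≤ 1 / 4 := by
  have hpb := isPolyBounded_sampleCount hq hm cD c₃
  obtain ⟨c₄₇, hc⟩ := eventually_polyBounded_le_pow hpb 16 0
  obtain ⟨ps, hps⟩ := hpb
  refine ⟨c₄₇ + 1, ?_⟩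
  have hexp := eventually_mul_eval_le_two_pow_half_dim ps 16
  filter_upwards [hc, hexp, eventually_ge_atTop 2] with n hcn hexpn h2
  have hn2 : (2 : ℝ) ≤ n := by exact_mod_cast h2
  have hn0 : (0 : ℝ) < n := by linarith
  set m : ℝ := (sampleCount q m₃ cD c₃ n : ℝ) with hmdef
  have hm0 : 0 ≤ m := by rw [hmdef]; positivity
  have hmle : m ≤ ((ps.eval n : ℕ) : ℝ) := by rw [hmdef]; exact_mod_cast hps n
  -- `16 m ≤ 2^{⌊d/2⌋} ≤ 2^{d+1}`
  have h1 : 16 * m ≤ (2 : ℝ) ^ (dim n + 1) := by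
    calc 16 * m ≤ 16 * ((ps.eval n : ℕ) : ℝ) := by gcongr
      _ ≤ (2 : ℝ) ^ (dim n / 2) := hexpn
      _ ≤ (2 : ℝ) ^ (dim n + 1) := pow_le_pow_right₀ (by norm_num) (by omega)
  -- `16 m ≤ n^{c₄₇}` so `m/n^{c₄₇+1} ≤ 1/(16 n) ≤ 1/32`
  have h2' : 16 * m ≤ (n : ℝ) ^ c₄₇ := by
    have := hcn
    rw [pow_zero, mul_one] at this
    linarith
  have hp : (0 : ℝ) < (2 : ℝ) ^ (dim n + 1) := by positivity
  have hpc : (0 : ℝ) < (n : ℝ) ^ (c₄₇ + 1) := by positivity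
  have hA : 2 * m * ((2 : ℝ) ^ (dim n + 1))⁻¹ ≤ 1 / 8 := by
    rw [← div_eq_mul_inv, div_le_iff₀ hp]
    linarith
  have hB : 2 * m * (1 / (n : ℝ) ^ (c₄₇ + 1)) ≤ 1 / 8 := by
    rw [mul_one_div, div_le_iff₀ hpc, pow_succ]
    nlinarith [pow_nonneg hn0.le c₄₇]
  calc 2 * m * (((2 : ℝ) ^ (dim n + 1))⁻¹ + 1 / (n : ℝ) ^ (c₄₇ + 1))
      = 2 * m * ((2 : ℝ) ^ (dim n + 1))⁻¹ + 2 * m * (1 / (n : ℝ) ^ (c₄₇ + 1)) := by ring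
    _ ≤ 1 / 8 + 1 / 8 := add_le_add hA hB
    _ = 1 / 4 := by norm_num

/-- **The raising term fits**: eventually `m·(1/(2Qα₂)) ≤ 1/(12m)` (`12 m² ≤ 2Qα₂` as `Qα₂ ≥ Q/(8nq)` beats polynomials).
[cite: BrakerskiEtAl2013, Thm. 4.1 (proof: "the trivial reduction … incurs no loss") with RegevLWE2009, Lemma 4.3] -/
theorem eventually_raise_term (hq : IsPolyBounded q) (hm : IsPolyBounded m₃) (cD c₃ : ℕ)
    (hα : ∀ᶠ n : ℕ in atTop, 0 < α n ∧ α n < 1 ∧ Real.sqrt n * Real.log n ≤ α n * q n) :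
    ∀ᶠ n : ℕ in atTop, (sampleCount q m₃ cD c₃ n : ℝ) * (1 / (2 * modulus n * rate₂ α n)) ≤ etaStar q m₃ cD c₃ n := by
  obtain ⟨ps, hps⟩ := isPolyBounded_sampleCount hq hm cD c₃
  obtain ⟨pq, hpq⟩ := hq
  have hexp := eventually_mul_eval_le_two_pow_half_dim (ps ^ 2 * Polynomial.X * pq) 48
  filter_upwards [hexp, eventually_inv_rate_le hα, eventually_ge_atTop 1] with n hexpn hinv h1
  obtain ⟨hα0, hα1, h1αq, -⟩ := hinv
  have hn1 : (1 : ℝ) ≤ n := by exact_mod_cast h1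
  have hn0 : (0 : ℝ) < n := by linarith
  have hn : 0 < n := h1
  have hq0 : (0 : ℝ) < q n := by
    by_contra h; push Not at h; nlinarith
  have hdn : (dim n : ℝ) ≤ n := by exact_mod_cast Nat.sqrt_le_self n
  have hd1 : (1 : ℝ) ≤ dim n := by exact_mod_cast Nat.sqrt_pos.2 hn
  have hα₂ : 1 / (8 * n * q n) ≤ rate₂ α n := by
    unfold rate₂
    rw [div_le_div_iff₀ (by positivity) (by positivity)]
    nlinarith [mul_le_mul_of_nonneg_left hdn (by positivity : (0 : ℝ) ≤ 8 * α n * q n)]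
  have hα₂pos : 0 < rate₂ α n := lt_of_lt_of_le (by positivity) hα₂
  have hQ : (0 : ℝ) < modulus n := by exact_mod_cast Nat.pos_of_ne_zero (NeZero.ne (modulus n))
  have hQge : (2 : ℝ) ^ (dim n / 2) ≤ modulus n := by
    unfold modulus; push_cast; rw [pow_add]
    nlinarith [pow_pos (by norm_num : (0 : ℝ) < 2) (dim n / 2)]
  set m : ℝ := (sampleCount q m₃ cD c₃ n : ℝ) with hmdef
  have hm0 : 0 ≤ m := by rw [hmdef]; positivity
  have hmle : m ≤ ((ps.eval n : ℕ) : ℝ) := by rw [hmdef]; exact_mod_cast hps n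
  have hqle : (q n : ℝ) ≤ ((pq.eval n : ℕ) : ℝ) := by exact_mod_cast hpq n
  -- `48 m² n q ≤ 2^{⌊d/2⌋} ≤ Q`
  have hev : 48 * (m ^ 2 * n * q n) ≤ modulus n := by
    have h := hexpn
    push_cast [Polynomial.eval_mul, Polynomial.eval_pow, Polynomial.eval_X] at h
    calc 48 * (m ^ 2 * n * q n) ≤ 48 * (((ps.eval n : ℕ) : ℝ) ^ 2 * n * ((pq.eval n : ℕ) : ℝ)) := by gcongr
      _ ≤ (2 : ℝ) ^ (dim n / 2) := h
      _ ≤ modulus n := hQge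
  -- hence `12 m² ≤ 2 Q α₂`
  have hkey : 12 * m ^ 2 ≤ 2 * modulus n * rate₂ α n := by
    have h1' : 12 * m ^ 2 = (48 * (m ^ 2 * n * q n)) * (1 / (8 * n * q n)) * 2 := by field_simp; ring
    rw [h1']
    have := mul_le_mul hev hα₂ (by positivity) hQ.le
    nlinarith
  unfold etaStar
  rw [← hmdef]
  rcases hm0.eq_or_lt with hmz | hmpos
  · rw [← hmz]; norm_num
  · rw [mul_one_div, div_le_div_iff₀ (by positivity) (by positivity)]
    nlinarith

/-- **The threshold is admissible** (`hη` of `section4_selected`): if the estimation error is `≤ 1/8`, `Δ_LHL ≤ 1/8`,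
`2mℓ ≤ 1/4` and the raising term is `≤ η⋆ = 1/(12m)`… precisely `η⋆' := η⋆` satisfies
`η⋆ ≤ (1 - E - Δ - 2mℓ)/(2m+1) - R` whenever `R ≤ 1/(12m)` (`(1/2)/(2m+1) ≥ 1/(6m)`). [cite: BrakerskiEtAl2013, Thm. 4.1 (proof)] -/
theorem etaStar_admissible {cD c₃ n : ℕ} (hm : 0 < sampleCount q m₃ cD c₃ n) {E Δ ℓ R : ℝ} (hE : E ≤ 1 / 8) (hΔ : Δ ≤ 1 / 8)
    (hℓ : 2 * (sampleCount q m₃ cD c₃ n : ℝ) * ℓ ≤ 1 / 4) (hR : R ≤ etaStar q m₃ cD c₃ n) :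
    etaStar q m₃ cD c₃ n ≤ (1 - E - Δ - 2 * (sampleCount q m₃ cD c₃ n : ℝ) * ℓ) / (2 * (sampleCount q m₃ cD c₃ n : ℝ) + 1) - R := by
  have hm' : (1 : ℝ) ≤ sampleCount q m₃ cD c₃ n := by exact_mod_cast hm
  set m : ℝ := (sampleCount q m₃ cD c₃ n : ℝ) with hmdef
  have hη : etaStar q m₃ cD c₃ n = 1 / (12 * m) := by unfold etaStar; rw [hmdef]
  rw [hη] at hR ⊢
  have h1 : 1 / (6 * m) ≤ (1 - E - Δ - 2 * m * ℓ) / (2 * m + 1) := by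
    rw [div_le_div_iff₀ (by positivity) (by positivity)]
    nlinarith
  have h2 : 1 / (12 * m) = 1 / (6 * m) - 1 / (12 * m) := by field_simp; norm_num
  linarith

/-- **The final advantage is inverse polynomial**: for some `c'`, eventually `1/n^{c'} ≤ 1/(48m)` (whenever `m₃(n) ≥ 1`).
[cite: BrakerskiEtAl2013, p. 13] -/
theorem eventually_final_advantage (hq : IsPolyBounded q) (hm : IsPolyBounded m₃) (cD c₃ : ℕ) :
    ∃ c' : ℕ, ∀ᶠ n : ℕ in atTop, 0 < m₃ n → 1 / (n : ℝ) ^ c' ≤ 1 / (48 * (sampleCount q m₃ cD c₃ n : ℝ)) := by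
  obtain ⟨c', hc⟩ := eventually_polyBounded_le_pow (isPolyBounded_sampleCount hq hm cD c₃) 48 0
  refine ⟨c', ?_⟩
  filter_upwards [hc, eventually_ge_atTop 1] with n hcn h1 hm3
  rw [pow_zero, mul_one] at hcn
  have hmpos : (0 : ℝ) < sampleCount q m₃ cD c₃ n := by exact_mod_cast sampleCount_pos h1 hm3
  exact one_div_le_one_div_of_le (by positivity) hcn

end BLPRS2013

end Literature.Computability.Cryptography

end
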